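import Literature.NumberTheory.BeurlingPrimes.WellBehavedSystems
import Literature.NumberTheory.BeurlingPrimes.WellBehavedSystemsSec4Proofs
import Literature.NumberTheory.BeurlingPrimes.WellBehavedSystemsThm32Proofs
import HarnessLib

/-!
# Discharges of named facts of `BeurlingCounterexamples.lean`

`Literature/Barriers/RiemannHypothesis/BeurlingCounterexamplesHolds.lean` — proofs-only
sibling of `BeurlingCounterexamples.lean` (no definitions, no named facts). Each theorem below
closes a named fact `X : Prop` of that file as `X_holds : X` by composing an ACCEPTED
reduction theorem of the tree with the ACCEPTED unconditional `_holds` discharges of all of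
its hypotheses; nothing is re-proved and no statement is changed. Recorded by the librarian
sweep g25 (2026-08-16, pass 5c: facts dischargeable in one line from the tree's own lemmas),
so that the facts census, `#h21_route_deps` and the cone guardrail see these facts as
theorems.

Discharged here:

* `BrouckeDebruyneRevesz2023_thm11_holds` := `BrouckeDebruyneRevesz2023_thm11_of_cases`
  `BrouckeDebruyneRevesz2023_cor33_holds` `BrouckeDebruyneRevesz2023_cor34_holds`
  `BrouckeDebruyneRevesz2023_sec4_holds` (`WellBehavedSystems.lean`).

## References

* [BrouckeDebruyneRevesz2023] — see `lean/references.bib` and the docstring of the fact in `BeurlingCounterexamples.lean`.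
-/

namespace Literature.Barriers.RiemannHypothesis

/-- **Discharge of the named fact `BrouckeDebruyneRevesz2023_thm11`**
(`BeurlingCounterexamples.lean`): Broucke–Debruyne–Révész 2023, Theorem 1.1 (unconditional):
"For any `α ∈ [0,1)` and `β ∈ [1/2, 1)` there exists an `[α, β]`-system." (Template systems
with prescribed zeros/poles or extreme growth, discretized by the Broucke–Vindas random
approximation, … — obtained as `BrouckeDebruyneRevesz2023_thm11_of_cases` applied to the
tree's unconditional discharges `BrouckeDebruyneRevesz2023_cor33_holds`,
`BrouckeDebruyneRevesz2023_cor34_holds`, `BrouckeDebruyneRevesz2023_sec4_holds` of its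
hypotheses (reduction in `WellBehavedSystems.lean`).
[cite: BrouckeDebruyneRevesz2023, Theorem 1.1] -/
theorem BrouckeDebruyneRevesz2023_thm11_holds :
    BrouckeDebruyneRevesz2023_thm11 :=
  Literature.NumberTheory.BeurlingPrimes.BrouckeDebruyneRevesz2023_thm11_of_cases
    Literature.NumberTheory.BeurlingPrimes.BrouckeDebruyneRevesz2023_cor33_holds
    Literature.NumberTheory.BeurlingPrimes.BrouckeDebruyneRevesz2023_cor34_holds
    Literature.NumberTheory.BeurlingPrimes.BrouckeDebruyneRevesz2023_sec4_holds

end Literature.Barriers.RiemannHypothesis
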